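import Literature.NumberTheory.LFunctions.ZetaSpacingDensityRH
import Literature.NumberTheory.LFunctions.PairCorrelationSmallGaps
import Literature.NumberTheory.LFunctions.CloseCriticalZerosWitness
import HarnessLib

/-!
# Montgomery's pair correlation conjecture gives `μ_{D_d} = 0` — a positive density of gaps
# between DISTINCT zeta zeros at every scale — hence (with RH) Conrey–Iwaniec's spacing
# hypothesis (1.22) and, modulo their Theorem 1.2, an effective `L(1, χ) ≫ (log q)^{−90}`

Topic `Literature/NumberTheory/LFunctions` (namespace `Literature.NumberTheory.LFunctions`).
PROOFS ONLY: no definition, no named fact. Written for the cell `landau-siegel` (LANDAU–SIEGEL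
PROGRAMME, rung F-S3, §C literature harvest, reader r6 «pair-correlation CONDITIONAL eliminations of
exceptional zeros»). The literature states the implication in one sentence and never as a theorem:

* B. Conrey, H. Iwaniec, Acta Arith. 103 (2002), §1 p. 3: "The well justified Pair Correlation
  Conjecture … does imply (1.24) with any `θ > 0` for a positive density of zeros".
  [cite: ConreyIwaniec2002, §1 p. 3 (PCC remark)]
* S. A. C. Baluyot, J. Number Theory 169 (2016), §1 (p. 184): "a disproof of the Alternative
  Hypothesis would be useful in showing that Landau-Siegel zeros do not exist. Indeed, Conrey and
  Iwaniec [5] … A corollary of their Theorem 1.2 is that if the number of ordinates `γ_n ≤ T` for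
  which the spacings (1.2) are less than `0.49`, say, is `≫ T(log T)^{4/5}` (as `T → ∞`), then
  `L(1, χ) ≫ (log q)^{−90}`." [cite: Baluyot2016AH, §1]
* D. A. Goldston, T. S. Trudgian, C. L. Turnage-Butterbaugh, JMAA 527 (2023), §1: "a positive
  proportion of consecutive zeros within any small multiple of the average spacing, a conclusion
  that is also a consequence of Montgomery's pair correlation conjecture."

The tree already holds both ends: `MontgomeryPairCorrelation.smallGaps`
(`PairCorrelationSmallGaps.lean`: pair correlation ⇒ `≥ A·N(T)` indices with `0 < δ_n ≤ μ`, gaps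
normalised by `log γ_n`) and the Bui–Goldston–Milinovich–Montgomery bookkeeping of
`ZetaSpacingDensityRH.lean` (`BGMM2023.GapDensityPos λ` = a positive density of DISTINCT consecutive
zeros `γ_n < γ_{n+1} ≤ γ_n + 2πλ/log T`; on RH, `GapDensityPos λ` with `λ < ½` ⇒ Conrey–Iwaniec's
count (1.22) eventually — `BGMM2023.le_ncard_closeCriticalZeros_of_gapDensityPos` — and, with one
close pair below height `2001`, `SubnormalGapsHypothesis c` and the `L(1,χ)` bound modulo
`conreyIwaniec2002_theorem12`). What was missing is the link in the `log T`-normalisation that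
`GapDensityPos` uses; it is supplied here by re-running the binning argument of
`PairCorrelationSmallGaps.lean` (whose published lemmas `card_sameBin_add_card_le`,
`two_mul_card_window_le`, `card_leftEnds_le`, `integral_sineGap_ge/le` are reused verbatim) and
stopping one step earlier, before the passage to `δ_n`:

* **`MontgomeryPairCorrelation.gapDensityPos`** — pair correlation ⇒ `GapDensityPos λ` for every
  `λ > 0`; equivalently **`MontgomeryPairCorrelation.muDdLe_zero`**: `μ_{D_d} ≤ 0` (so `= 0`) in the
  notation of Bui–Goldston–Milinovich–Montgomery (their RH record is `μ_{D_d} ≤ 1.0522`,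
  `BGMM2023.buiEtAl2023_corollary2`; Conrey–Iwaniec's threshold is `½`);
* **`eventually_closeCriticalZeros_ge_of_pairCorrelation`** — RH + pair correlation ⇒ there is
  `c > 0` with `#closeCriticalZeros T ≥ c·T log T` for all large `T`;
* **`subnormalGapsHypothesis_of_pairCorrelation`** — RH + pair correlation + ONE close critical pair
  below height `2001` (`(closeCriticalZeros 2001).Nonempty`, a finite numerical statement left as
  an explicit hypothesis) ⇒ `∃ c > 0, SubnormalGapsHypothesis c` ((1.22) as printed, "for any
  `T ≥ 2001`");
* **`lOne_lower_bound_of_pairCorrelation`** — modulo the named fact `conreyIwaniec2002_theorem12`: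
  `‖L(1, χ)‖ ≥ c′ (log q)^{−90}` for every primitive quadratic ODD `χ` mod `q > 4`.

CAVEAT, recorded because the folklore phrase «pair correlation kills Siegel zeros» over-claims:
the conclusion is an effective lower bound of POLYLOGARITHMIC type, `L(1, χ) ≫ (log q)^{−90}`
(`h(−q) ≫ √q (log q)^{−90}`; via `|L(1,χ)| ≪ (1 − β)(log q)²` only real zeros of quality
`η ≫ (log q)^{91}` are excluded) — NOT the region `σ > 1 − c/log q` of the tree's `NoSiegelZeros`,
nor `¬ UnboundedSiegelZeros`; and it is conditional on RH besides pair correlation (Conrey–Iwaniec,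
p. 3: under RH "one still cannot conclude unconditional, effective bound (1.23)"). «The programme
SEARCHES and TYPES; no claim about Landau–Siegel zeros, Theorems 1–2 of arXiv:2211.02515 or a
repaired Margin232 until a kernel theorem says so.»

## References

* [ConreyIwaniec2002] B. Conrey, H. Iwaniec, *Spacing of zeros of Hecke L-functions and the class
  number problem*, Acta Arith. 103 (2002) 259–312, §1 p. 3, Theorem 1.2 (1.22)–(1.23).
* [Baluyot2016AH] S. A. C. Baluyot, J. Number Theory 169 (2016) 183–226, §1.
* [BuiEtAl2023] H. M. Bui, D. A. Goldston, M. B. Milinovich, H. L. Montgomery, Acta Arith. 210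
  (2023) 133–153, §1 (1.4) (tree: `BGMM2023.GapDensityPos`, `BGMM2023.MuDdLe`).
* [Montgomery1973] H. L. Montgomery, Proc. Sympos. Pure Math. 24 (1973), Conjecture (12)
  (tree: `MontgomeryPairCorrelation`).
* [BombieriGarrett2020] E. Bombieri, P. Garrett, §7.5 (the deduction typed as
  `MontgomeryPairCorrelation.smallGaps`).
-/

noncomputable section

open Complex Filter Set
open scoped Real Topology

namespace Literature.NumberTheory.LFunctions

open PairCorrelationSmallGaps BGMM2023

/-- **Pair correlation ⇒ `μ_{D_d} = 0`: a positive density of gaps between DISTINCT consecutive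
zeros below `2πλ/log T`, for every `λ > 0`.** Assume Montgomery's pair correlation conjecture
(`MontgomeryPairCorrelation`, the `N(T)`-normalised form with the `δ`-term — a statement about
the ordinates, no RH needed for this deduction). Then for every `λ > 0` there are `A > 0`, `T₀`
with `A·N(T) ≤ #{n < N(T) : γ_n < γ_{n+1} ≤ γ_n + 2πλ/log T}` for `T ≥ T₀`, i.e.
`BGMM2023.GapDensityPos λ`. The proof is the binning argument of
`MontgomeryPairCorrelation.smallGaps` (bins of width `2π(β/10)/log T`, `β = min λ 3/10`,
`A = β³/200`) stopped before the passage to the `log γ_n`-normalised gaps `δ_n`.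
[cite: ConreyIwaniec2002, §1 p. 3 (PCC remark)] [cite: BombieriGarrett2020, §7.5] -/
theorem MontgomeryPairCorrelation.gapDensityPos (hpc : MontgomeryPairCorrelation) {lam : ℝ}
    (hlam : 0 < lam) : GapDensityPos lam := by
  -- parameters: `β = min λ (3/10)`, windows `[β/2, β]` and `[−β/10, β/10]`
  set β : ℝ := min lam (3 / 10) with hβ_def
  have hβ0 : 0 < β := lt_min hlam (by norm_num)
  have hβlam : β ≤ lam := min_le_left _ _
  have hβ3 : β ≤ 3 / 10 := min_le_right _ _
  have hb3 : 0 < β ^ 3 := pow_pos hβ0 3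
  have hc₁ : 7 * β ^ 3 / 24 ≤ ∫ u in (β / 2)..β, (1 - sineKernel u ^ 2) := by
    calc 7 * β ^ 3 / 24 = (β ^ 3 - (β / 2) ^ 3) / 3 := by ring
      _ ≤ _ := integral_sineGap_ge (half_pos hβ0) (by linarith) hβ3
  have hc₂ : ∫ u in (-(β / 10))..(β / 10), (1 - sineKernel u ^ 2) ≤ β ^ 3 / 300 := by
    calc _ ≤ 10 * (β / 10) ^ 3 / 3 := integral_sineGap_le (by positivity)
      _ = β ^ 3 / 300 := by ring
  have hlim₁ := hpc (β / 2) β (by linarith)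
  have hlim₂ := hpc (-(β / 10)) (β / 10) (by linarith)
  rw [if_neg (fun h ↦ by rw [Set.mem_Icc] at h; linarith [h.1]), add_zero] at hlim₁
  rw [if_pos (Set.mem_Icc.2 ⟨by linarith, by linarith⟩)] at hlim₂
  have hev₁ := hlim₁.eventually_const_lt (show 7 * β ^ 3 / 24 - β ^ 3 / 300 < _ by linarith)
  have hev₂ := hlim₂.eventually_lt_const (show _ < β ^ 3 / 300 + 1 + β ^ 3 / 300 by linarith)
  obtain ⟨T₀, hT₀⟩ := eventually_atTop.1 (hev₁.and (hev₂.and (eventually_gt_atTop (1 : ℝ))))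
  refine ⟨β ^ 3 / 200, by positivity, T₀, fun T hT ↦ ?_⟩
  obtain ⟨h₁, h₂, h₃⟩ := hT₀ T hT
  have hL : 0 < Real.log T := Real.log_pos h₃
  rcases Nat.eq_zero_or_pos (zetaZeroCount T) with hN0 | hNpos
  · rw [hN0, Nat.cast_zero, mul_zero]; positivity
  have hNr : (0 : ℝ) < zetaZeroCount T := by exact_mod_cast hNpos
  rw [lt_div_iff₀ hNr] at h₁
  rw [div_lt_iff₀ hNr] at h₂
  -- the counts
  set w : ℝ := 2 * π * (β / 10) / Real.log T with hw_def
  have hw : 0 < w := by positivity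
  set I := zeroIndexSet T with hI
  set E := (I ×ˢ I).filter fun p ↦ p.1 ≠ p.2 ∧ ⌊zetaOrdinate p.1 / w⌋ = ⌊zetaOrdinate p.2 / w⌋
    with hE
  set S := I.filter fun i ↦ ∃ j ∈ I, 2 * π * (β / 2) / Real.log T ≤ zetaOrdinate j - zetaOrdinate i ∧
    zetaOrdinate j - zetaOrdinate i ≤ 2 * π * β / Real.log T with hS
  set G := I.filter fun n ↦ 0 < zetaOrdinate (n + 1) - zetaOrdinate n ∧
    zetaOrdinate (n + 1) - zetaOrdinate n ≤ 2 * π * β / Real.log T with hG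
  have hk₃ : E.card + zetaZeroCount T ≤ pairCorrelationCount (-(β / 10)) (β / 10) T := by
    have := card_sameBin_add_card_le (T := T) (η := β / 10) (by positivity) hL
    rwa [card_zeroIndexSet] at this
  have hk₄ : 2 * pairCorrelationCount (β / 2) β T ≤ (10 + 1) * (2 * E.card + 3 * S.card) := by
    have := two_mul_card_window_le zetaOrdinate I (a := 2 * π * (β / 2) / Real.log T)
      (d := 2 * π * β / Real.log T) (by positivity) hw 10 (le_of_eq (by rw [hw_def]; ring))
    rwa [card_window_eq_pairCorrelationCount] at this
  have hk₅ : S.card ≤ G.card + E.card :=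
    card_leftEnds_le zetaOrdinate_mono_holds w (zetaZeroCount T) (by positivity)
  -- `G` is the distinct-gap count at scale `β`, which is at most the one at scale `λ`
  have hk₆ : G.card ≤ gapCount lam T := by
    have hGeq : G.card = gapCount β T := by
      rw [hG, hI, gapCount, zeroIndexSet]
      congr 1
      refine Finset.filter_congr fun n _ ↦ ?_
      rw [sub_pos]
    rw [hGeq]
    exact gapCount_mono hβlam h₃.le
  -- cast to `ℝ` and conclude by linear arithmetic
  have hk₃' : (E.card : ℝ) + zetaZeroCount T ≤ pairCorrelationCount (-(β / 10)) (β / 10) T := by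
    exact_mod_cast hk₃
  have hk₄' : (2 : ℝ) * pairCorrelationCount (β / 2) β T ≤ (10 + 1) * (2 * E.card + 3 * S.card) := by
    exact_mod_cast hk₄
  have hk₅' : (S.card : ℝ) ≤ G.card + E.card := by exact_mod_cast hk₅
  have hk₆' : (G.card : ℝ) ≤ gapCount lam T := by exact_mod_cast hk₆
  linarith

/-- **Pair correlation ⇒ `μ_{D_d} ≤ 0`** (hence `μ_{D_d} = μ_D = μ = 0`) in the notation of
Bui–Goldston–Milinovich–Montgomery: every `λ > 0` carries a positive density of distinct gaps
below `2πλ/log T`. Their RH record is `μ_{D_d} ≤ 1.0522` (`BGMM2023.buiEtAl2023_corollary2`);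
Conrey–Iwaniec's threshold is `½`. [cite: ConreyIwaniec2002, §1 p. 3 (PCC remark)] -/
theorem MontgomeryPairCorrelation.muDdLe_zero (hpc : MontgomeryPairCorrelation) : MuDdLe 0 :=
  fun _ hlam ↦ hpc.gapDensityPos hlam

/-- **RH + Montgomery's pair correlation conjecture ⇒ Conrey–Iwaniec's (1.22), eventually and with
room to spare:** there is `c > 0` such that for all large `T` the number of ordinates
`γ ∈ (0, T]` of critical zeros of `ζ` with a critical neighbour `γ′ ≠ γ`,
`|γ − γ′| ≤ (π/log γ)(1 − 1/√log γ)`, is `≥ c·T log T` (Conrey–Iwaniec ask only for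
`≫ T(log T)^{4/5}`) — `MontgomeryPairCorrelation.gapDensityPos` at `λ = 1/4 < ½` fed into
`BGMM2023.le_ncard_closeCriticalZeros_of_gapDensityPos`.
[cite: ConreyIwaniec2002, §1 p. 3 (PCC remark)] [cite: Baluyot2016AH, §1] -/
theorem eventually_closeCriticalZeros_ge_of_pairCorrelation (hRH : RiemannHypothesis)
    (hpc : MontgomeryPairCorrelation) :
    ∃ c : ℝ, 0 < c ∧ ∃ T₁ : ℝ, ∀ T : ℝ, T₁ ≤ T →
      c * T * Real.log T ≤ ((closeCriticalZeros T).ncard : ℝ) :=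
  le_ncard_closeCriticalZeros_of_gapDensityPos hRH (lam := 1 / 4) (by norm_num) (by norm_num)
    (hpc.gapDensityPos (by norm_num))

/-- **RH + pair correlation + ONE close critical pair below height `2001` ⇒ Conrey–Iwaniec's
hypothesis (1.22) exactly as printed** ("`≫ T(log T)^{4/5}` for any `T ≥ 2001`"). The low-height
pair is a finite numerical statement about the zeros of `ζ` up to height `2001`, kept as an
explicit hypothesis (to be discharged by a certified zero computation, not here).
[cite: ConreyIwaniec2002, Theorem 1.2 (1.22)] [cite: Baluyot2016AH, §1] -/
theorem subnormalGapsHypothesis_of_pairCorrelation (hRH : RiemannHypothesis)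
    (hpc : MontgomeryPairCorrelation) (hlow : (closeCriticalZeros 2001).Nonempty) :
    ∃ c : ℝ, 0 < c ∧ SubnormalGapsHypothesis c :=
  subnormalGapsHypothesis_of_eventually
    (eventually_closeCriticalZeros_ge_of_pairCorrelation hRH hpc) hlow

/-- **The pair-correlation route to an effective `L(1, χ)` lower bound, assembled** (modulo the
named fact `conreyIwaniec2002_theorem12`): RH, Montgomery's pair correlation conjecture and one
close critical pair below height `2001` give `‖L(1, χ)‖ ≥ c′ (log q)^{−90}` for every primitive
quadratic odd `χ` mod `q > 4` (Conrey–Iwaniec's `χ = (−q/·)`, `−q` a fundamental discriminant),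
`c′ > 0` absolute. A POLYLOG-type bound: it excludes real zeros of quality `η ≫ (log q)^{91}` only,
not the region `σ > 1 − c/log q`. [cite: ConreyIwaniec2002, Theorem 1.2] [cite: Baluyot2016AH, §1] -/
theorem lOne_lower_bound_of_pairCorrelation (hCI : conreyIwaniec2002_theorem12)
    (hRH : RiemannHypothesis) (hpc : MontgomeryPairCorrelation)
    (hlow : (closeCriticalZeros 2001).Nonempty) :
    ∃ c' : ℝ, 0 < c' ∧ ∀ (q : ℕ) [NeZero q], 4 < q → ∀ χ : DirichletCharacter ℂ q,
      χ.IsPrimitive → χ.IsQuadratic → χ.Odd →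
        c' * Real.log q ^ (-(90 : ℝ)) ≤ ‖χ.LFunction 1‖ :=
  lOne_lower_bound_of_gapDensityPos hCI hRH (lam := 1 / 4) (by norm_num) (by norm_num)
    (hpc.gapDensityPos (by norm_num)) hlow

/-! ### The chain with the low-height pair discharged in the kernel

`CloseCriticalZerosWitness.lean` certifies the pair `γ₉₉₆ ≈ 1415.59`, `γ₉₉₇ ≈ 1415.78` by three
Riemann–Siegel signs of Hardy's `Z` (modulo Gabcke's remainder bound `Gabcke.satz322b_R0`, the named
fact behind every Riemann–Siegel certificate of the tree), so the numerical hypothesis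
`(closeCriticalZeros 2001).Nonempty` above is replaced by that named fact. -/

/-- **RH + pair correlation ⇒ Conrey–Iwaniec's hypothesis (1.22)**, the low-height pair supplied by
the kernel certificate `closeCriticalZeros_2001_nonempty` (modulo Gabcke's Riemann–Siegel remainder
bound). [cite: ConreyIwaniec2002, Theorem 1.2 (1.22)] [cite: Gabcke1979, Satz 3.2.2 (b) p. 55] -/
theorem subnormalGapsHypothesis_of_pairCorrelation_gabcke (hG : Gabcke.satz322b_R0)
    (hRH : RiemannHypothesis) (hpc : MontgomeryPairCorrelation) :
    ∃ c : ℝ, 0 < c ∧ SubnormalGapsHypothesis c :=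
  subnormalGapsHypothesis_of_pairCorrelation hRH hpc (closeCriticalZeros_2001_nonempty hG)

/-- **The pair-correlation route to `L(1, χ) ≫ (log q)^{−90}`, with no numerical hypothesis left**:
modulo the two named facts `conreyIwaniec2002_theorem12` (Conrey–Iwaniec's Theorem 1.2) and
`Gabcke.satz322b_R0` (Gabcke's remainder bound, used only to certify one close pair of zeros below
height `2001`), RH and Montgomery's pair correlation conjecture give `‖L(1, χ)‖ ≥ c′ (log q)^{−90}`
for every primitive quadratic odd `χ` mod `q > 4`, `c′ > 0` absolute.
[cite: ConreyIwaniec2002, Theorem 1.2] [cite: Gabcke1979, Satz 3.2.2 (b) p. 55] -/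
theorem lOne_lower_bound_of_pairCorrelation_gabcke (hCI : conreyIwaniec2002_theorem12)
    (hG : Gabcke.satz322b_R0) (hRH : RiemannHypothesis) (hpc : MontgomeryPairCorrelation) :
    ∃ c' : ℝ, 0 < c' ∧ ∀ (q : ℕ) [NeZero q], 4 < q → ∀ χ : DirichletCharacter ℂ q,
      χ.IsPrimitive → χ.IsQuadratic → χ.Odd →
        c' * Real.log q ^ (-(90 : ℝ)) ≤ ‖χ.LFunction 1‖ :=
  lOne_lower_bound_of_pairCorrelation hCI hRH hpc (closeCriticalZeros_2001_nonempty hG)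

end Literature.NumberTheory.LFunctions

end
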